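import Mathlib
import HarnessLib

/-!
# Cauchy–Binet over all index tuples and positivity of determinantal (Gram) kernels

* `sum_det_submatrix_mul_det_submatrix` — the Cauchy–Binet formula summed over ALL maps
  `q : m → ι` (with repetitions): `∑_q det A[·, q] det B[q, ·] = |m|! · det (A B)` for
  `A : m × ι`, `B : ι × m` over a commutative ring (Gantmacher, *Theory of Matrices* I, Ch. I §2).
* `posSemidef_detSubmatrix` — for a positive semidefinite `𝔾 : ι × ι` over `ℝ`/`ℂ`, the
  tuple-indexed compound `(q, q') ↦ det 𝔾[q, q']` is positive semidefinite (`𝔾 = Rᴴ R` and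
  Cauchy–Binet exhibit it as `|m|!⁻¹ · FᴴF`).
* `det_one_add_eq_sum_gram` — the expansion that makes marginal reflection positivity of fermion
  determinants manifest: for square `P, P'`, `Y₀` positive definite and `Y_T` arbitrary,
  `det (1 + P'ᴴ Y_T P Y₀) = ∑_{q q'} Ψ_{q'}(P) · Q_{q' q} · conj (Ψ_q(P'))` with the features
  `Ψ_q(P) = det ((fromRows 1 P)[q, ·])` and the coupling
  `Q_{q' q} = det Y₀ · |σ|!⁻² · det 𝔾[q, q']`, `𝔾 = diag(Y₀⁻¹, Y_T)`; `Q` is positive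
  semidefinite when `Y_T` is (`posSemidef_gramCoupling`).
All statements are proved. [folklore]
-/

noncomputable section

namespace Literature.LinearAlgebra.Matrix

open _root_.Matrix Finset

section CauchyBinet

variable {m ι : Type*} [Fintype m] [DecidableEq m] [Fintype ι] {R : Type*} [CommRing R]

/-- Expansion of `det (A * B)` over all maps `p : m → ι` (columns of `A` / rows of `B` selected
with repetition): `det (A B) = ∑_p (∏ᵢ B (p i) i) · det A[·, p]`. [folklore] -/
theorem det_mul_eq_sum_pi' (A : Matrix m ι R) (B : Matrix ι m R) :
    (A * B).det = ∑ p : m → ι, (∏ i, B (p i) i) * (A.submatrix id p).det := by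
  simp only [det_apply', mul_apply, prod_univ_sum, mul_sum, Fintype.piFinset_univ]
  rw [Finset.sum_comm]
  refine Finset.sum_congr rfl fun p _ => ?_
  refine Finset.sum_congr rfl fun σ _ => ?_
  simp only [submatrix_apply, id, prod_mul_distrib]
  ring

/-- **Cauchy–Binet over all index tuples.** For `A : m × ι` and `B : ι × m`,
`∑_{q : m → ι} det A[·, q] · det B[q, ·] = |m|! · det (A B)`: each `m`-element column selection
is counted once for every ordering, and selections with repetitions contribute `0`
(Gantmacher 1959, Ch. I §2). [folklore] -/
theorem sum_det_submatrix_mul_det_submatrix (A : Matrix m ι R) (B : Matrix ι m R) :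
    ∑ q : m → ι, (A.submatrix id q).det * (B.submatrix q id).det =
      (Fintype.card m).factorial * (A * B).det := by
  set G : (m → ι) → R := fun p => (∏ i, B (p i) i) * (A.submatrix id p).det with hG
  have hR : ∀ q : m → ι, (A.submatrix id q).det * (B.submatrix q id).det =
      ∑ τ : Equiv.Perm m, G (q ∘ τ) := by
    intro q
    rw [det_apply' (B.submatrix q id), Finset.mul_sum]
    refine Finset.sum_congr rfl fun τ _ => ?_
    simp only [hG]
    have : A.submatrix id (q ∘ ⇑τ) = (A.submatrix id q).submatrix id τ := rfl
    rw [this, det_permute']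
    simp only [submatrix_apply, id, Function.comp]
    ring
  simp_rw [hR]
  rw [Finset.sum_comm]
  have hinner : ∀ τ : Equiv.Perm m, ∑ q : m → ι, G (q ∘ τ) = ∑ q : m → ι, G q := fun τ =>
    Fintype.sum_equiv (Equiv.arrowCongr τ (Equiv.refl ι)).symm _ _ fun q => rfl
  simp_rw [hinner]
  rw [Finset.sum_const, Finset.card_univ, Fintype.card_perm, nsmul_eq_mul, det_mul_eq_sum_pi']

end CauchyBinet

section Positivity

variable {m ι : Type*} [Fintype m] [DecidableEq m] [Fintype ι] [DecidableEq ι]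
variable {𝕜 : Type*} [RCLike 𝕜]

open scoped ComplexOrder MatrixOrder

/-- A positive semidefinite matrix over `ℝ`/`ℂ` is a Gram matrix `Rᴴ R` (with `R` its positive
square root). [folklore] -/
theorem exists_eq_conjTranspose_mul_self_of_posSemidef {G : Matrix ι ι 𝕜} (hG : G.PosSemidef) :
    ∃ R : Matrix ι ι 𝕜, G = Rᴴ * R := by
  refine ⟨CFC.sqrt G, ?_⟩
  have hs : IsSelfAdjoint (CFC.sqrt G) := (CFC.sqrt_nonneg G).isSelfAdjoint
  rw [← star_eq_conjTranspose, hs.star_eq, CFC.sqrt_mul_sqrt_self G hG.nonneg]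

/-- **The tuple-indexed compound of a positive semidefinite matrix is positive semidefinite**:
for `𝔾 ≥ 0` the matrix `(q, q') ↦ det 𝔾[q, q']` on `m → ι` is `≥ 0` (write `𝔾 = RᴴR`; by
Cauchy–Binet `|m|! · det 𝔾[q,q'] = ∑_r conj (det R[r,q]) det R[r,q']`). [folklore] -/
theorem posSemidef_detSubmatrix {G : Matrix ι ι 𝕜} (hG : G.PosSemidef) :
    (Matrix.of fun q q' : m → ι => (G.submatrix q q').det).PosSemidef := by
  obtain ⟨R, rfl⟩ := exists_eq_conjTranspose_mul_self_of_posSemidef hG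
  set F : Matrix (m → ι) (m → ι) 𝕜 := Matrix.of fun r q => (R.submatrix r q).det with hF
  have hfact : ((Fintype.card m).factorial : 𝕜) ≠ 0 := Nat.cast_ne_zero.2 (Nat.factorial_ne_zero _)
  have hkey : Matrix.of (fun q q' : m → ι => ((Rᴴ * R).submatrix q q').det) =
      ((Fintype.card m).factorial : 𝕜)⁻¹ • (Fᴴ * F) := by
    ext q q'
    rw [Matrix.of_apply, Matrix.smul_apply, Matrix.mul_apply, smul_eq_mul]
    have hsub : (Rᴴ * R).submatrix q q' = Rᴴ.submatrix q id * R.submatrix id q' := by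
      rw [← Matrix.submatrix_mul _ _ _ id _ Function.bijective_id]
    rw [hsub, eq_inv_mul_iff_mul_eq₀ hfact, ← sum_det_submatrix_mul_det_submatrix]
    refine Finset.sum_congr rfl fun r _ => ?_
    simp only [hF, Matrix.conjTranspose_apply, Matrix.of_apply, ← Matrix.det_conjTranspose,
      Matrix.conjTranspose_submatrix, Matrix.submatrix_submatrix, Function.comp_id, Function.id_comp]
  rw [hkey]
  refine (Matrix.posSemidef_conjTranspose_mul_self F).smul ?_
  rw [← RCLike.ofReal_natCast, ← RCLike.ofReal_inv]
  exact RCLike.ofReal_nonneg.2 (inv_nonneg.2 (Nat.cast_nonneg _))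

end Positivity

section Gram

variable {σ : Type*} [Fintype σ] [DecidableEq σ] {𝕜 : Type*} [RCLike 𝕜]

open scoped ComplexOrder MatrixOrder

/-- The feature of the Gram expansion: `Ψ_q(P) = det ((fromRows 1 P)[q, ·])`, the minor of the
stacked matrix `[1; P]` with rows selected (with repetition) by `q : σ → σ ⊕ σ`. [folklore] -/
def gramFeature (P : Matrix σ σ 𝕜) (q : σ → σ ⊕ σ) : 𝕜 :=
  ((Matrix.fromRows (1 : Matrix σ σ 𝕜) P).submatrix q id).det

/-- The coupling matrix of the Gram expansion: `Q_{q' q} = det Y₀ · |σ|!⁻² · det 𝔾[q, q']` with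
`𝔾 = diag(Y₀⁻¹, Y_T)`. [folklore] -/
def gramCoupling (Y₀ YT : Matrix σ σ 𝕜) : Matrix (σ → σ ⊕ σ) (σ → σ ⊕ σ) 𝕜 :=
  Matrix.of fun q' q => Y₀.det * (((Fintype.card σ).factorial : 𝕜)⁻¹) ^ 2 *
    ((Matrix.fromBlocks Y₀⁻¹ 0 0 YT).submatrix q q').det

/-- **The coupling matrix is positive semidefinite** for `Y₀` positive definite and `Y_T`
positive semidefinite. [folklore] -/
theorem posSemidef_gramCoupling {Y₀ YT : Matrix σ σ 𝕜} (h₀ : Y₀.PosDef) (hT : YT.PosSemidef) :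
    (gramCoupling Y₀ YT).PosSemidef := by
  have hG : (Matrix.fromBlocks Y₀⁻¹ 0 0 YT).PosSemidef := by
    rw [Matrix.posSemidef_iff_dotProduct_mulVec]
    refine ⟨Matrix.IsHermitian.fromBlocks h₀.inv.isHermitian (by simp) hT.isHermitian, fun x => ?_⟩
    rw [← Sum.elim_comp_inl_inr x, Matrix.fromBlocks_mulVec]
    simp only [Matrix.zero_mulVec, add_zero, zero_add, Sum.elim_comp_inl, Sum.elim_comp_inr]
    rw [Function.star_sumElim, sumElim_dotProduct_sumElim]
    exact add_nonneg ((Matrix.posSemidef_iff_dotProduct_mulVec.mp h₀.inv.posSemidef).2 _)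
      ((Matrix.posSemidef_iff_dotProduct_mulVec.mp hT).2 _)
  have hc : (0 : 𝕜) ≤ Y₀.det * (((Fintype.card σ).factorial : 𝕜)⁻¹) ^ 2 := by
    refine mul_nonneg h₀.det_pos.le ?_
    rw [← RCLike.ofReal_natCast, ← RCLike.ofReal_inv, ← RCLike.ofReal_pow]
    exact RCLike.ofReal_nonneg.2 (sq_nonneg _)
  have heq : gramCoupling Y₀ YT = (Y₀.det * (((Fintype.card σ).factorial : 𝕜)⁻¹) ^ 2) •
      (Matrix.of fun q q' : σ → σ ⊕ σ => ((Matrix.fromBlocks Y₀⁻¹ 0 0 YT).submatrix q q').det)ᵀ := by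
    ext q' q
    simp only [gramCoupling, Matrix.of_apply, Matrix.smul_apply, Matrix.transpose_apply, smul_eq_mul]
  rw [heq]
  exact ((posSemidef_detSubmatrix (m := σ) hG).transpose).smul hc

/-- **Gram expansion of `det (1 + P'ᴴ Y_T P Y₀)`.** For `Y₀` invertible,
`det (1 + P'ᴴ Y_T P Y₀) = ∑_{q' q} Ψ_{q'}(P) · Q_{q' q} · conj (Ψ_q(P'))`, because
`det (1 + P'ᴴY_TPY₀) = det Y₀ · det ([1; P']ᴴ · diag(Y₀⁻¹, Y_T) · [1; P])` and Cauchy–Binet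
(twice, over all row selections). With `P = 𝔓(U)` the positive-time transfer product of a gauge
field and `P' = 𝔓(ΘU)` that of its reflection, this exhibits the antiperiodic Wilson fermion
determinant as a reflection-positive Gram kernel. [folklore] -/
theorem det_one_add_eq_sum_gram (P P' Y₀ YT : Matrix σ σ 𝕜) (h₀ : IsUnit Y₀.det) :
    (1 + P'ᴴ * YT * P * Y₀).det =
      ∑ q', ∑ q, gramFeature P q' * gramCoupling Y₀ YT q' q * (starRingEnd 𝕜) (gramFeature P' q) := by
  set n : 𝕜 := ((Fintype.card σ).factorial : 𝕜) with hn
  have hfact : n ≠ 0 := Nat.cast_ne_zero.2 (Nat.factorial_ne_zero _)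
  -- `det (1 + N Y₀) = det (Y₀⁻¹ + N) det Y₀`
  have h1 : (1 + P'ᴴ * YT * P * Y₀).det = (Y₀⁻¹ + P'ᴴ * YT * P).det * Y₀.det := by
    rw [← Matrix.det_mul, add_mul, Matrix.nonsing_inv_mul _ h₀]
  -- `Y₀⁻¹ + N = [1; P']ᴴ 𝔾 [1; P]`
  have h2 : Y₀⁻¹ + P'ᴴ * YT * P = (Matrix.fromRows (1 : Matrix σ σ 𝕜) P')ᴴ *
      (Matrix.fromBlocks Y₀⁻¹ 0 0 YT * Matrix.fromRows (1 : Matrix σ σ 𝕜) P) := by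
    rw [Matrix.conjTranspose_fromRows_eq_fromCols_conjTranspose, ← Matrix.mul_assoc,
      Matrix.fromCols_mul_fromBlocks, Matrix.fromCols_mul_fromRows]
    simp [Matrix.mul_assoc]
  rw [h1, h2]
  set G := Matrix.fromBlocks Y₀⁻¹ 0 0 YT with hGdef
  set F := Matrix.fromRows (1 : Matrix σ σ 𝕜) P with hFdef
  set F' := Matrix.fromRows (1 : Matrix σ σ 𝕜) P' with hF'def
  -- the two Cauchy–Binet expansions
  have hA : ∀ q : σ → σ ⊕ σ, (F'ᴴ.submatrix id q).det = (starRingEnd 𝕜) (gramFeature P' q) := by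
    intro q
    rw [← Matrix.conjTranspose_submatrix, Matrix.det_conjTranspose, gramFeature, RCLike.star_def]
  have hB : ∀ q : σ → σ ⊕ σ, ((G * F).submatrix q id).det =
      n⁻¹ * ∑ q' : σ → σ ⊕ σ, (G.submatrix q q').det * gramFeature P q' := by
    intro q
    rw [Matrix.submatrix_mul G F q id id Function.bijective_id, Matrix.submatrix_id_id,
      eq_inv_mul_iff_mul_eq₀ hfact, hn, ← sum_det_submatrix_mul_det_submatrix]
    refine Finset.sum_congr rfl fun q' _ => ?_
    simp only [Matrix.submatrix_submatrix, Function.comp_id, Function.id_comp, gramFeature, hFdef]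
  have h3 := sum_det_submatrix_mul_det_submatrix F'ᴴ (G * F)
  rw [← hn] at h3
  have hdet : (F'ᴴ * (G * F)).det = n⁻¹ * ∑ q : σ → σ ⊕ σ, (starRingEnd 𝕜) (gramFeature P' q) *
      (n⁻¹ * ∑ q' : σ → σ ⊕ σ, (G.submatrix q q').det * gramFeature P q') := by
    rw [eq_inv_mul_iff_mul_eq₀ hfact, ← h3]
    simp only [hA, hB]
  rw [hdet]
  simp only [gramCoupling, Matrix.of_apply, Finset.mul_sum, Finset.sum_mul, ← hGdef]
  rw [Finset.sum_comm]
  refine Finset.sum_congr rfl fun q _ => Finset.sum_congr rfl fun q' _ => ?_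
  ring

end Gram

end Literature.LinearAlgebra.Matrix

end
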